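import Literature.NumberTheory.EllipticCurves.PadicPointsFiniteIndexProofs
import HarnessLib

/-!
# Bhargava–Shankar, eq. (31) (`bhargavaShankar_sum_irredClassCount_asymptotic`): the proved frontier,
# a concordance with the published version, and the divisibility step of its Prop. 3.18

`Proofs` companion of `BhargavaShankarCounting.lean` (theorems only: no definitions, no named facts).
Source: M. Bhargava, A. Shankar, *Binary quartic forms having bounded invariants, and the
boundedness of the average rank of elliptic curves*, Ann. of Math. (2) 181 (2015) 191–242
(`BhargavaShankarAnnals2015`). The tree's files on this paper quote the held arXiv text
`arXiv:1006.1002v2` (June 2010); the published version is the text of `arXiv:1006.1002v3`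
(Dec. 2013), whose §2.5–2.7 and §3 replace v2's §2.5, §3.6–3.7 and §5. Numbers tagged "v3" below
were read off the LaTeX source of v3 (one theorem counter per section shared by theorems, lemmas,
propositions, corollaries and remarks).

## 1. The frontier of eq. (31)

The named fact `Literature.NumberTheory.EllipticCurves.bhargavaShankar_sum_irredClassCount_asymptotic`
(v2 §5.4, display (31) with Prop. 5.12 and Lemma 5.16 folded in; v3 §3.6, the display in the
proof of Thm 3.19, with Prop. 3.9 and Lemma 3.20) follows from exactly **two** named facts of the tree, everything else in
its printed derivation being proved (`BhargavaShankarEq31Proofs`, `BhargavaShankarLocalMassesProofs`,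
`BhargavaShankarClassCountProofs`, `BinaryQuarticRealTypesProofs`, `PadicPointsFiniteIndexProofs`):

* (†) `bhargavaShankar_locSolIrredClassCount_asymptotic` — the sieve step, v2 display (31), lines
  1–2 = v3, proof of Thm 3.19, first display, lines 1–2: `N(S^F; 2¹²X) = N(V_ℤ^{(0)} ∪ V_ℤ^{(2+)} ∪ V_ℤ^{(1)}; 2¹²X) ·
  ∏_p |2¹⁰/27|_p (1 − p⁻²) ∫_{F_p^{inv}} #(E/2E)/#E[2] dI dJ + o(X^{5/6})`;
* `bhargavaShankar_classCount` — Thm. 2.1 (both versions): `N(V_ℤ^{(i)}; X) = c_i ζ(2) X^{5/6} +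
  O(X^{3/4+ε})`, `(c₀, c₁, c₂) = (4, 32, 8)/135`;

Lemma 5.16 of v2 (= Lemma 3.20 of v3, Brumer–Kramer) being discharged
(`brumerKramer_card_quotient_two_holds`). This is `bhargavaShankar_sum_irredClassCount_asymptotic_of_two_facts`.

## 2. Concordance v2 ↔ v3 for the statements bearing on (†) and Thm. 2.1

| v2 (held text)                          | v3 (= published)                        | content |
|-----------------------------------------|-----------------------------------------|---------|
| Thm 2.1, Lemmas 2.2–2.4                 | Thm 2.1, Lemmas 2.2–2.4                 | count of `GL₂(ℤ)`-classes; stabilisers; reducible forms `O(X^{2/3+ε})`; large stabilisers `O(X^{3/4+ε})` |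
| §2.3 (formula for `N(S;X)`)             | Thm 2.5                                 | the averaging formula for `N(S;X)` |
| Prop 2.5 (Davenport), Prop 2.6          | Prop 2.6, Prop 2.7                      | lattice points in `B(n,t,λ,X)` |
| Prop 2.7, Prop 2.8                      | Prop 2.8; §3.4 (Props 3.10–3.13, Lemma 3.15) | change of measure `dv = (2/27 n_i) dg dI dJ`; its `p`-adic form with constant `|1/27|_p` |
| Lemma 2.9, Prop 2.10, Thm 2.11          | Lemma 2.9, Prop 2.10, Thm 2.11          | eligible `(I,J)`; their count; finitely many congruence conditions |
| —                                       | Thm 2.12                                | weighted version of Thm 2.11 (finitely many local weights `φ_{p_j}` defined mod `p_j^{a_j}`) |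
| Prop 3.18 / Prop 5.13 (via §4)          | Thm 2.13 (⇐ Thms 2.14, 2.17–2.20, Prop 2.16) | uniformity: `lim_X N(∪_{p>M} W_p(V); X)/X^{5/6} = O(1/log M)`, `W_p(V) = {p² ∣ Δ}` |
| "proof identical to Thm (mcc)", §3.7    | Thm 2.21                                | the squarefree sieve: `N_φ(V_ℤ^{(i)};X) = N(V_ℤ^{(i)};X) ∏_p ∫ φ_p + o(X^{5/6})` for acceptable `φ` |
| Lemma 5.2; Lemmas 5.3–5.5; Thm 5.6      | Prop 3.3; Lemma 3.4; Thm 3.5            | `2`-coverings ↔ locally soluble quartics; minimisation at `p ≥ 5`, `3`, `2`; the parametrization |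
| Lemmas 5.10–5.11                        | Thm 3.2                                 | `E(K)/2E(K) ↔` soluble `PGL₂(K)`-orbits; `Stab_{PGL₂(K)}(f) ≅ E(K)[2]` |
| `S^F`, Prop 5.12                        | weights `1/m(f)`, Prop 3.6, Prop 3.7, Cor 3.8, Prop 3.9 | `m(f) = ∏_p m_p(f)` (class number one of `PGL₂`); `∫_{S_p(F)} df/m_p(f) = |2¹⁰/27|_p Vol(PGL₂(ℤ_p)) M_p(V,F)` |
| Prop 5.13 (proof)                       | Prop 3.18                               | `f` bad at `p > 2` (insoluble, or `m_p(f) ≠ 1`) `⇒ p² ∣ Δ(f)` |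
| Lemma 5.15                              | Prop 3.16, Thm 3.17                     | number of curves of height `< X` in a large family |
| Thm 5.14, Lemma 5.16                    | Thm 3.19, Lemma 3.20                    | the ratio; Brumer–Kramer |

## 3. What a discharge of (†) consists of, in the architecture of v3 (nothing of this is in the tree)

(†) for the family `F` of all curves is, in v3, the first display of the proof of Thm 3.19, lines
1–2, whose printed proof is "by Theorem 2.21 and Propositions 3.6, 3.9, and 3.18":
1. `N(S^F; Y)` (the tree's `locSolIrredClassCount Y`, a count of `PGL₂(ℚ)`-classes) equals the
   number of `PGL₂(ℤ)`-orbits (= `GL₂(ℤ)`-orbits, `−1` acting trivially) of locally soluble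
   irreducible `f` with invariants in `2⁴·F^{inv} × 2⁶·F^{inv}` and `H(f) < Y`, each weighted by
   `1/n(f)`, `n(f)` = number of `PGL₂(ℤ)`-orbits in the `PGL₂(ℚ)`-class of `f` in `V_ℤ` (v3 §3.2,
   first two paragraphs; elementary); and `n(f) = m(f) := Σ_{f' ∈ B(f)} #Aut_ℚ(f')/#Aut_ℤ(f')` for
   all but `O(Y^{3/4+ε})` orbits (Lemma 2.4).
2. `m(f) = ∏_p m_p(f)` (Prop 3.6: injectivity is elementary, surjectivity is "`PGL₂(ℚ)` has class
   number one", [PRAG, Ch. 8]).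
3. `φ(f) = ∏_p φ_p(f)` with `φ_p = 1_{ℚ_p-soluble} · 1_{(I,J) ∈ 2⁴·Inv_p(F) × 2⁶·Inv_p(F)} / m_p` is
   acceptable (`φ_p(f) = 1` whenever `p² ∤ Δ(f)`, `p` large: Prop 3.18, whose second half needs
   "`p ∤ Δ(f) ⇒ f` is `ℚ_p`-soluble" (source: "see [Cremona, *Algorithms*, Ch. 3.6]"; the
   standard argument is Hasse–Weil for the genus-one curve `z² = f` over `𝔽_p` plus Hensel) and
   the `(1²2)` case) and each `φ_p` is locally constant
   off a closed null set (local constancy of `ℚ_p`-solubility and of `m_p` off `Δ = 0`; not spelled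
   out in the source).
4. Thm 2.21 applied to `φ` on `V_ℤ^{(0)}`, `V_ℤ^{(1)}`, `V_ℤ^{(2+)}`; its proof (v3 §2.7, one page)
   uses Thm 2.12, Thm 2.13, Thm 2.1 and the bound `∫_{p² ∣ Δ(f)} df ≪ p⁻²` ([BPS, proof of Thm 3.2]).
5. `∫_{V_{ℤ_p}} φ_p = ∫_{S_p(F)} df/m_p(f) = |2¹⁰/27|_p (1 − p⁻²) ∫_{Inv_p(F)} #(E/2E)/#E[2] dI dJ`
   (Prop 3.9 ⇐ Cor 3.8 ⇐ Prop 3.7, the `p`-adic change-of-measure formula with constant `|1/27|_p`,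
   §3.4, and Thm 3.2).
Thm 2.1 itself is v3 §2.1–2.4 (reduction theory, Thm 2.5, Davenport's lemma Prop 2.6, Prop 2.7,
Lemmas 2.2–2.4, the volume computation Prop 2.8 with `Vol(SL₂(ℤ)\SL₂(ℝ)) = ζ(2)`).
Inputs external to the paper: Davenport's lemma [Davenport1951]; Bhargava's quantitative Ekedahl
sieve [geosieve, Thm 3.3] (Thm 2.17); [dodqf, Prop. 23] (Thm 2.19); Delone/Evertse's bound `≤ 12`
for cubic Thue equations `g(x,y) = 1` (Prop 2.16); Hasse–Weil in genus one (Prop 3.18).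

## 4. Proved here

* `bhargavaShankar_sum_irredClassCount_asymptotic_of_two_facts` (§1).
* The divisibility behind the first half of Prop 3.18 (v3): if `γ = diag(p^k, 1)`, `k ≥ 1`, takes
  `f ∈ V_ℤ` into `V_ℤ` under the twisted action `γ · f = (det γ)⁻² f((x,y)γ)`, then `p ∣ d(f)` and
  `p² ∣ e(f)`, hence `p² ∣ Δ(f)` (`BinaryQuartic.disc_eq_d_sq_mul_add_e_mul`, `BinaryQuartic.sq_dvd_disc_of_dvd_d_of_sq_dvd_e`,
  `BinaryQuartic.sq_dvd_disc_of_sq_dvd_a_of_dvd_b`,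
  `BinaryQuartic.sq_dvd_disc_of_twisted_diagonal_integral`). (The source phrases it with the roles
  of `(a, b)` and `(d, e)` exchanged, i.e. for `γ = diag(1, p^k)`; both are given.)

## References

* M. Bhargava, A. Shankar, Ann. of Math. (2) 181 (2015) 191–242; arXiv:1006.1002v2 (held) and v3.
  [cite: BhargavaShankarAnnals2015, §5.4 eq. (31) (arXiv:1006.1002v2 numbering) = §3.6, proof of Thm 3.19 (v3)]
* M. Bhargava, The geometric sieve and the density of squarefree values of invariant polynomials
  (`geosieve`); M. Bhargava, Ann. of Math. 162 (2005) (`dodqf`); K. Belabas, M. Bhargava,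
  C. Pomerance, Duke Math. J. 153 (2010) (`BPS`/`BBP`) — cited through the source only.
-/

noncomputable section

open scoped Classical

namespace Literature.NumberTheory.EllipticCurves

open BinaryQuartic

/-! ## §1. The frontier theorem -/

/-- **Bhargava–Shankar, eq. (31) in the tree's normalisation
(`bhargavaShankar_sum_irredClassCount_asymptotic`), granted exactly the two remaining named inputs**:
the sieve step (†) of display (31) (`bhargavaShankar_locSolIrredClassCount_asymptotic`: v2 display
(31), lines 1–2 = v3, proof of Thm 3.19, first display, i.e. Thm 2.21 + Props 3.6, 3.9, 3.18 of v3) and Thm 2.1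
(`bhargavaShankar_classCount`); Lemma 5.16 (Brumer–Kramer) is the tree's theorem
`brumerKramer_card_quotient_two_holds`, and the assembly is `sum_irredClassCount_asymptotic_of_sieve`.
[cite: BhargavaShankarAnnals2015, §5.4 eq. (31) with Prop. 5.12 and Lemma 5.16 (arXiv:1006.1002v2 numbering)] -/
theorem bhargavaShankar_sum_irredClassCount_asymptotic_of_two_facts
    (hG : bhargavaShankar_locSolIrredClassCount_asymptotic) (h16 : bhargavaShankar_classCount) :
    bhargavaShankar_sum_irredClassCount_asymptotic :=
  sum_irredClassCount_asymptotic_of_sieve hG h16 brumerKramer_card_quotient_two_holds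

/-! ## §4. The divisibility step of Prop. 3.18 (v3) -/

namespace BinaryQuartic

variable {R : Type*} [CommRing R]

/-- Reversal `(a,b,c,d,e) ↦ (e,d,c,b,a)`, i.e. `f(y,x)`, preserves the discriminant. [folklore] -/
theorem disc_reverse (f : BinaryQuartic R) :
    (⟨f.e, f.d, f.c, f.b, f.a⟩ : BinaryQuartic R).disc = f.disc := by
  simp only [disc]; ring

/-- `Δ(f) = d²·A + e·B` with explicit integral polynomials `A`, `B` in the coefficients: every
monomial of the discriminant has `(degree in d) + 2·(degree in e) ≥ 2`. [folklore] -/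
theorem disc_eq_d_sq_mul_add_e_mul (f : BinaryQuartic R) :
    f.disc = f.d ^ 2 * (-27 * f.a ^ 2 * f.d ^ 2 + 18 * f.a * f.b * f.c * f.d - 4 * f.a * f.c ^ 3
        - 4 * f.b ^ 3 * f.d + f.b ^ 2 * f.c ^ 2)
      + f.e * (256 * f.a ^ 3 * f.e ^ 2 - 192 * f.a ^ 2 * f.b * f.d * f.e - 128 * f.a ^ 2 * f.c ^ 2 * f.e
        + 144 * f.a ^ 2 * f.c * f.d ^ 2 + 144 * f.a * f.b ^ 2 * f.c * f.e - 6 * f.a * f.b ^ 2 * f.d ^ 2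
        - 80 * f.a * f.b * f.c ^ 2 * f.d + 16 * f.a * f.c ^ 4 - 27 * f.b ^ 4 * f.e
        + 18 * f.b ^ 3 * f.c * f.d - 4 * f.b ^ 2 * f.c ^ 3) := by
  simp only [disc]; ring

/-- **`π ∣ d` and `π² ∣ e` imply `π² ∣ Δ(f)`** (over any commutative ring) — the divisibility
behind the first paragraph of the proof of Prop. 3.18 of the published version: a form carried into
`V_{ℤ_p}` by `diag(pᵏ, 1)`, `k ≥ 1`, under the twisted action has `p ∣ d`, `p² ∣ e`
(`sq_dvd_disc_of_twisted_diagonal_integral`). [cite: BhargavaShankarAnnals2015, Prop. 3.18, proof, first paragraph (published = arXiv:1006.1002v3 numbering)] -/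
theorem sq_dvd_disc_of_dvd_d_of_sq_dvd_e (f : BinaryQuartic R) {π : R} (hd : π ∣ f.d)
    (he : π ^ 2 ∣ f.e) : π ^ 2 ∣ f.disc := by
  rw [disc_eq_d_sq_mul_add_e_mul]
  exact dvd_add (dvd_mul_of_dvd_left (pow_dvd_pow_of_dvd hd 2) _) (dvd_mul_of_dvd_left he _)

/-- **`π² ∣ a` and `π ∣ b` imply `π² ∣ Δ(f)`** — the form in which the source states it ("the
`x⁴`-coefficient of `f` is divisible by `p²` and the `x³y`-coefficient of `f` is divisible by `p`,
implying that `p² ∣ Δ(f)`"), from the previous lemma by the symmetry `f(x,y) ↦ f(y,x)`.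
[cite: BhargavaShankarAnnals2015, Prop. 3.18, proof, first paragraph (published = arXiv:1006.1002v3 numbering)] -/
theorem sq_dvd_disc_of_sq_dvd_a_of_dvd_b (f : BinaryQuartic R) {π : R} (ha : π ^ 2 ∣ f.a)
    (hb : π ∣ f.b) : π ^ 2 ∣ f.disc := by
  rw [← disc_reverse]
  exact sq_dvd_disc_of_dvd_d_of_sq_dvd_e ⟨f.e, f.d, f.c, f.b, f.a⟩ hb ha

/-- **First half of Prop. 3.18 of the published version, for the representative `γ = diag(pᵏ, 1)`.**
If `k ≥ 1`, `p ≠ 0`, and the twisted translate `γ · f = (det γ)⁻² f((x,y)γ)` of an integral form `f`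
is again integral — i.e. `(pᵏ)² g = f((x,y)·diag(pᵏ,1))` for an integral `g` (`subst_diagonal` of
`BinaryQuarticMinimisationPrimeProofs`) — then `p ∣ d(f)`,
`p² ∣ e(f)` and therefore `p² ∣ Δ(f)`. (In the source: "by replacing `f` with a
`PGL₂(ℤ_p)`-translate if necessary, we may assume that `γ = diag(p^a, p^b)` with `a > b = 0`. It
then follows that [two coefficients are divisible by `p²` and `p`], implying that `p² ∣ Δ(f)`";
the reduction of a general `γ ∈ PGL₂(ℚ_p) ∖ PGL₂(ℤ_p)` to this representative — the Cartan
decomposition — is not carried out here.)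
[cite: BhargavaShankarAnnals2015, Prop. 3.18, proof, first paragraph (published = arXiv:1006.1002v3 numbering)] -/
theorem sq_dvd_disc_of_twisted_diagonal_integral (f g : BinaryQuartic ℤ) {p : ℤ} (hp : p ≠ 0)
    {k : ℕ} (hk : 1 ≤ k) (h : ((p ^ k) ^ 2 : ℤ) • g = f.subst !![p ^ k, 0; 0, 1]) :
    p ∣ f.d ∧ p ^ 2 ∣ f.e ∧ p ^ 2 ∣ f.disc := by
  rw [subst_diagonal] at h
  have hpk : (p ^ k : ℤ) ≠ 0 := pow_ne_zero _ hp
  -- compare the `d`- and `e`-coefficients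
  have hd' : (p ^ k) ^ 2 * g.d = f.d * p ^ k * 1 ^ 3 := by
    have := congrArg BinaryQuartic.d h; simpa using this
  have he' : (p ^ k) ^ 2 * g.e = f.e * 1 ^ 4 := by
    have := congrArg BinaryQuartic.e h; simpa using this
  have hd : p ∣ f.d := by
    have h1 : f.d = p ^ k * g.d := by
      have h2 : (f.d - p ^ k * g.d) * p ^ k = 0 := by rw [sub_mul]; linear_combination -hd'
      rcases mul_eq_zero.mp h2 with h3 | h3
      · exact sub_eq_zero.mp h3
      · exact absurd h3 hpk
    rw [h1]
    exact dvd_mul_of_dvd_left (dvd_pow_self p (by omega)) _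
  have he : p ^ 2 ∣ f.e := by
    have h1 : f.e = (p ^ k) ^ 2 * g.e := by linear_combination -he'
    rw [h1, ← pow_mul]
    exact dvd_mul_of_dvd_left (pow_dvd_pow p (by omega)) _
  exact ⟨hd, he, sq_dvd_disc_of_dvd_d_of_sq_dvd_e f hd he⟩

end BinaryQuartic

end Literature.NumberTheory.EllipticCurves

end
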